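import Literature.ComputerArithmetic.Shewchuk1997.Compress
import Mathlib.Tactic.Linarith
import Mathlib.Tactic.Positivity
import Mathlib.Tactic.Ring
import Mathlib.Tactic.NormNum

/-!
# Scale covariance of `ulp`, ties-to-even rounding and COMPRESS (new work)

New work of the certified-arithmetic venture (ENGINES group: shared numerical engines serving
client cells; rigour lives in the verifiers; every published number belongs to a client cell's
ledger, not to the engines group).  Bookkeeping identities, not published theorems.

Binary floating point is self-similar: multiplying by `2^e` and shifting the underflow threshold
`emin` by `e` changes nothing.  Exactly (no normal-range hypothesis):

* `ulp_mul_two_zpow` — `ulp_{p,emin}(q·2^e) = ulp_{p,emin−e}(q)·2^e`;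
* `roundTiesEven_mul_two_zpow` — `RN_e^{p,emin}(q·2^e) = RN_e^{p,emin−e}(q)·2^e`
  (the tree's `roundTiesEven_two_mul` is the case `e = 1` at FIXED `emin`, which needs
  `|t| ≥ 2^(emin+p−1)`; shifting `emin` along removes the hypothesis);
* `fastTwoSum_mul`, `compressDown_map_mul`, `compressUp_map_mul`, `compress_map_mul` — for any pair
  of roundings with `fl(x·c) = fl′(x)·c` (`c ≠ 0`), FAST-TWO-SUM and both sweeps of Shewchuk's
  COMPRESS [Shewchuk1997, §2.7] commute with the scaling `x ↦ x·c`: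
  `COMPRESS_fl(e·c) = COMPRESS_fl′(e)·c`.

Use: a COMPRESS computation carried out once on small integers (`emin′ ≤ 0`) transports to every
binade `2^s` (with `emin ≤ s`), which is how the parametric families of `CompressPassesUnbounded`
are evaluated.
-/

namespace Summit.Ventures.CertifiedArithmetic.Expansions

open Literature.ComputerArithmetic.JeannerodRump2018
open Literature.ComputerArithmetic.BoldoJeannerodMelquiondMuller2023 hiding twoSum twoSum_fst
open Literature.ComputerArithmetic.Shewchuk1997

variable {p : ℕ} {emin : ℤ}

/-! ### `ulp` and `RN_e` under `q ↦ q·2^e`, `emin ↦ emin − e` -/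

/-- `⌊log₂|q·2^e|⌋ = ⌊log₂|q|⌋ + e` (`q ≠ 0`). [cite: BoldoEtAl2023, §2.1] -/
theorem int_log_abs_mul_two_zpow {q : ℚ} (hq : q ≠ 0) (e : ℤ) :
    Int.log 2 |q * (2 : ℚ) ^ e| = Int.log 2 |q| + e := by
  have hqpos : 0 < |q| := abs_pos.mpr hq
  have h2e : 0 < (2 : ℚ) ^ e := zpow_pos (by norm_num) e
  have habs : |q * (2 : ℚ) ^ e| = |q| * 2 ^ e := by rw [abs_mul, abs_of_pos h2e]
  have hpos : 0 < |q| * (2 : ℚ) ^ e := mul_pos hqpos h2e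
  rw [habs]
  have hlo : (2 : ℚ) ^ (Int.log 2 |q| + e) ≤ |q| * 2 ^ e := by
    rw [zpow_add₀ (by norm_num : (2 : ℚ) ≠ 0)]
    exact mul_le_mul_of_nonneg_right (Int.zpow_log_le_self (by norm_num) hqpos) h2e.le
  have hhi : |q| * (2 : ℚ) ^ e < 2 ^ (Int.log 2 |q| + e + 1) := by
    rw [show Int.log 2 |q| + e + 1 = (Int.log 2 |q| + 1) + e by ring,
      zpow_add₀ (by norm_num : (2 : ℚ) ≠ 0)]
    exact mul_lt_mul_of_pos_right (Int.lt_zpow_succ_log_self (by norm_num) |q|) h2e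
  have h1 := (Int.zpow_le_iff_le_log (b := 2) (by norm_num) hpos).mp hlo
  have h2 := (Int.lt_zpow_iff_log_lt (b := 2) (by norm_num) hpos).mp hhi
  omega

/-- **`ulp` is scale covariant**: `ulp_{p,emin}(q·2^e) = ulp_{p,emin−e}(q)·2^e` (also at `q = 0`).
[cite: BoldoEtAl2023, §2.1 Def. 2.4] -/
theorem ulp_mul_two_zpow (p : ℕ) (emin e : ℤ) (q : ℚ) :
    ulp p emin (q * (2 : ℚ) ^ e) = ulp p (emin - e) q * 2 ^ e := by
  have h2 : (2 : ℚ) ≠ 0 := by norm_num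
  by_cases hq : q = 0
  · rw [hq, zero_mul, ulp_zero, ulp_zero, ← zpow_add₀ h2, sub_add_cancel]
  · have hqe : q * (2 : ℚ) ^ e ≠ 0 := mul_ne_zero hq (zpow_ne_zero e h2)
    rw [ulp_of_ne_zero hqe, ulp_of_ne_zero hq, int_log_abs_mul_two_zpow hq e, ← zpow_add₀ h2,
      show max emin (Int.log 2 |q| + e - p + 1) = max (emin - e) (Int.log 2 |q| - p + 1) + e by
        rw [← max_add_add_right]; congr 1 <;> ring]

/-- **Ties-to-even is scale covariant**: `RN_e^{p,emin}(q·2^e) = RN_e^{p,emin−e}(q)·2^e` — both the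
neighbour selection and the parity of the integral significand are unchanged.
[cite: BoldoEtAl2023, §2.2 (p. 212, ties-to-even)] -/
theorem roundTiesEven_mul_two_zpow (p : ℕ) (emin e : ℤ) (q : ℚ) :
    roundTiesEven p emin (q * (2 : ℚ) ^ e) = roundTiesEven p (emin - e) q * 2 ^ e := by
  have h2e : 0 < (2 : ℚ) ^ e := zpow_pos (by norm_num) e
  have hu := ulp_mul_two_zpow p emin e q
  set u := ulp p (emin - e) q with hu_def
  have hupos : 0 < u := ulp_pos (p := p) (emin := emin - e) q
  have hdiv : q * (2 : ℚ) ^ e / (u * 2 ^ e) = q / u :=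
    mul_div_mul_right q u h2e.ne'
  unfold roundTiesEven
  rw [hu, hdiv, ← hu_def]
  set N : ℚ := (⌊q / u⌋ : ℚ) with hN
  have e1 : q * 2 ^ e - N * (u * 2 ^ e) = (q - N * u) * 2 ^ e := by ring
  have e2 : (N + 1) * (u * 2 ^ e) - q * 2 ^ e = ((N + 1) * u - q) * 2 ^ e := by ring
  have key : ∀ a b : ℚ, a * (2 : ℚ) ^ e < b * 2 ^ e ↔ a < b := fun a b =>
    ⟨fun h => lt_of_mul_lt_mul_right h h2e.le, fun h => mul_lt_mul_of_pos_right h h2e⟩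
  simp only [e1, e2, key]
  split_ifs <;> ring

/-! ### FAST-TWO-SUM and COMPRESS under a common scaling of the data -/

section scaling

variable {fl fl' : ℚ → ℚ} {c : ℚ}

/-- FAST-TWO-SUM commutes with scaling: if `fl(x·c) = fl′(x)·c` for all `x`, then
FAST-TWO-SUM_fl(a·c, b·c) = FAST-TWO-SUM_fl′(a, b)·c componentwise.
[cite: Shewchuk1997, §2.3 Theorem 6 (FAST-TWO-SUM)] -/
theorem fastTwoSum_mul (hfl : ∀ x, fl (x * c) = fl' x * c) (a b : ℚ) :
    fastTwoSum fl (a * c) (b * c) = ((fastTwoSum fl' a b).1 * c, (fastTwoSum fl' a b).2 * c) := by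
  simp only [fastTwoSum]
  rw [← add_mul, hfl, ← sub_mul, hfl, ← sub_mul, hfl]

/-- The downward sweep commutes with scaling (`c ≠ 0`, so the zero tests agree).
[cite: Shewchuk1997, §2.7 p. 332 (COMPRESS), Lines 1–9] -/
theorem compressDown_map_mul (hc : c ≠ 0) (hfl : ∀ x, fl (x * c) = fl' x * c) :
    ∀ (xs : List ℚ) (Q : ℚ), compressDown fl (Q * c) (xs.map (· * c)) =
      ((compressDown fl' Q xs).1.map (· * c), (compressDown fl' Q xs).2 * c)
  | [], Q => by simp
  | x :: xs, Q => by
    rw [List.map_cons]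
    have hf := fastTwoSum_mul hfl Q x
    by_cases h : (fastTwoSum fl' Q x).2 = 0
    · have h' : (fastTwoSum fl (Q * c) (x * c)).2 = 0 := by rw [hf]; simp [h]
      rw [compressDown_cons_of_eq_zero h', compressDown_cons_of_eq_zero h, hf]
      exact compressDown_map_mul hc hfl xs _
    · have h' : (fastTwoSum fl (Q * c) (x * c)).2 ≠ 0 := by rw [hf]; exact mul_ne_zero h hc
      rw [compressDown_cons_of_ne_zero h', compressDown_cons_of_ne_zero h, hf]
      dsimp only
      rw [compressDown_map_mul hc hfl xs _, List.map_cons]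

/-- The upward sweep commutes with scaling. [cite: Shewchuk1997, §2.7 p. 332 (COMPRESS), Lines 10–16] -/
theorem compressUp_map_mul (hc : c ≠ 0) (hfl : ∀ x, fl (x * c) = fl' x * c) :
    ∀ (gs : List ℚ) (Q : ℚ), compressUp fl (Q * c) (gs.map (· * c)) =
      (compressUp fl' Q gs).map (· * c)
  | [], Q => by simp
  | g :: gs, Q => by
    rw [List.map_cons]
    have hf := fastTwoSum_mul hfl g Q
    by_cases h : (fastTwoSum fl' g Q).2 = 0
    · have h' : (fastTwoSum fl (g * c) (Q * c)).2 = 0 := by rw [hf]; simp [h]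
      rw [compressUp_cons_of_eq_zero h', compressUp_cons_of_eq_zero h, hf]
      exact compressUp_map_mul hc hfl gs _
    · have h' : (fastTwoSum fl (g * c) (Q * c)).2 ≠ 0 := by rw [hf]; exact mul_ne_zero h hc
      rw [compressUp_cons_of_ne_zero h', compressUp_cons_of_ne_zero h, hf]
      dsimp only
      rw [compressUp_map_mul hc hfl gs _, List.map_cons]

/-- **COMPRESS commutes with scaling**: `COMPRESS_fl(e·c) = COMPRESS_fl′(e)·c` whenever
`fl(x·c) = fl′(x)·c` (`c ≠ 0`). [cite: Shewchuk1997, §2.7 p. 332 (COMPRESS)] -/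
theorem compress_map_mul (hc : c ≠ 0) (hfl : ∀ x, fl (x * c) = fl' x * c) (e : List ℚ) :
    compress fl (e.map (· * c)) = (compress fl' e).map (· * c) := by
  rcases List.eq_nil_or_concat e with rfl | ⟨l, x, rfl⟩
  · simp [compress]
  rw [List.concat_eq_append]
  have h1 : compress fl' (l ++ [x]) =
      compressUp fl' (compressDown fl' x l.reverse).2 (compressDown fl' x l.reverse).1.reverse := by
    simp [compress, List.reverse_append]
  have h2 : compress fl ((l ++ [x]).map (· * c)) = compressUp fl
      (compressDown fl (x * c) (l.reverse.map (· * c))).2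
      (compressDown fl (x * c) (l.reverse.map (· * c))).1.reverse := by
    simp [compress, List.reverse_append, List.map_reverse]
  rw [h2, h1, compressDown_map_mul hc hfl, ← List.map_reverse, compressUp_map_mul hc hfl]

end scaling

/-- The instance used for binades: with `fl = RN_e^{p,emin}` and `fl′ = RN_e^{p,emin−s}`,
`COMPRESS_fl(e·2^s) = COMPRESS_fl′(e)·2^s`. [cite: Shewchuk1997, §2.7 p. 332 (COMPRESS)] -/
theorem compress_map_mul_two_zpow (p : ℕ) (emin s : ℤ) (e : List ℚ) :
    compress (roundTiesEven p emin) (e.map (· * (2 : ℚ) ^ s)) =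
      (compress (roundTiesEven p (emin - s)) e).map (· * (2 : ℚ) ^ s) :=
  compress_map_mul (zpow_ne_zero s (by norm_num)) (roundTiesEven_mul_two_zpow p emin s) e

/-- … and for the bottom carry of the downward sweep.
[cite: Shewchuk1997, §2.7 p. 332 (COMPRESS), Lines 1–9] -/
theorem compressDown_mul_two_zpow_snd (p : ℕ) (emin s : ℤ) (Q : ℚ) (xs : List ℚ) :
    (compressDown (roundTiesEven p emin) (Q * (2 : ℚ) ^ s) (xs.map (· * (2 : ℚ) ^ s))).2 =
      (compressDown (roundTiesEven p (emin - s)) Q xs).2 * (2 : ℚ) ^ s := by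
  rw [compressDown_map_mul (zpow_ne_zero s (by norm_num)) (roundTiesEven_mul_two_zpow p emin s)]

end Summit.Ventures.CertifiedArithmetic.Expansions
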